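import Summits.BirchSwinnertonDyer.BirchSwinnertonDyer.Theses.ErratumRoadFive
import Summits.BirchSwinnertonDyer.BirchSwinnertonDyer.Theorems.ErratumRoadFiveRest3GZSharpIndex
import HarnessLib

/-!
# Route `ErratumRoadFive` (rung K2, `p ≥ 5`), crux `RamNoErratumDataAtFive` (item stmt-BirchSwinnertonDyer-19624, REST‴) and its
# registered stub `stub_rest3_tam` (REST⁗) BY NAME from GZ-sharp Heegner data (cell `bsd-stepL`, owner seat `bsd-stepL-rest-p2` g3;
# `--supports stmt-BirchSwinnertonDyer-19624`; THEOREMS ONLY — no definition, no named fact, no `sorry`)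

HONEST FRAMING. Class-level packaging of the Theses-free tool `ErratumRoadFiveRest3GZSharpIndex.lean` (§4
`openInputOnTreeAt_of_exists_gzSharpDatum_of_thm331Mult`), in the shape of the owner's p473288 §2 with the Tamagawa-slack
datum replaced by the GZ-sharp datum (minimal twist model `Wd`, attested `q_d = L(Wd,1)/Ω_{Wd}`, inequality
`2·ord_p [E(K):ℤP] ≤ ord_p q_d + ord_p ∏c_ℓ(E) + 2·ord_p #Wd(ℚ)_tors`). Every published named fact is a HYPOTHESIS (here: the
route's support items `PublishedInputsFive`, `JSWAnticyclotomicControlMult`); `hS♯` is a per-pair CERTIFICATE currency (false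
class-wide exactly where `Ш(E)[p] ≠ 0`), attested on the REST⁗ pairs `N < 5·10⁵` by the owner's census (HOME/rest/SLACK-CENSUS.md:
every computed row, negative controls included, at its own field). CONDITIONAL; BSD is proved for no pair; nothing booked (T7).

References: [GrossZagier1986] V.§2; [Gross1991] (1.1), (2.2); [JetchevSkinnerWan2017] Thm. 3.3.1, §7.4.1; [Skinner2016PacificMC]
Thm. C; [Castella2018Erratum] Thm. 1.1 (iii)–(iv).
-/

-- the Theorems namespace of this sub repeats the summit name by design (D-0017 nested layout)
set_option linter.dupNamespace false

noncomputable section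

open scoped Classical

namespace Summit.BirchSwinnertonDyer.BirchSwinnertonDyer.Theorems

open WeierstrassCurve NumberField Literature.NumberTheory.EllipticCurves
  Literature.NumberTheory.EllipticCurves.ModularForms
  Literature.NumberTheory.EllipticCurves.Rank1Residual
  Literature.NumberTheory.EllipticCurves.Rank1Residual.Typed
  Summit.BirchSwinnertonDyer.Rank1Residual Summit.BirchSwinnertonDyer.Rank1Residual.X11b
  Summit.BirchSwinnertonDyer.BirchSwinnertonDyer.Theses.ErratumRoadFive

/-! ## §5 Class level: the registered stub `stub_rest3_tam` VERBATIM and the crux BY NAME from GZ-sharp data -/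

/-- **`stub_rest3_tam` (registered signature VERBATIM) ⟸ GZ-sharp Heegner data on the REST⁗ pairs**: the published named
facts (Gross–Zagier, Kolyvagin, Skinner 2016 Thm. C, GZK, modularity), JSW17 Thm. 3.3.1-mult (`h331`), and `hS♯` — at every
X11b pair with `p ≥ 5`, `ρ̄` onto, a (ram) witness, `p ∣ ∏ c_ℓ` and no erratum datum, ONE GZ-sharp odd Heegner datum
(`d_K < −4`, `p ∤ c`, non-torsion Heegner point, a minimal twist model with an attested `q_d = L/Ω`, and the inequality) ⟹
the open input on REST⁗. Per pair a finite computation at ANY odd Heegner field; attested on the REST⁗ pairs `N < 5·10⁵`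
by the owner's census (every computed row, negative controls included). CONDITIONAL on every binder; `hS♯` is a certificate
currency (false class-wide exactly where `Ш(E)[p] ≠ 0`); nothing booked. [cite: Gross1991, (1.1), Thm. 1.3, (2.2)]
[cite: JetchevSkinnerWan2017, Thm. 3.3.1, §7.4.1 (pp. 30–31)] [cite: Skinner2016PacificMC, Thm. C (§1)] -/
theorem rest3Tam_of_gzSharpData_of_thm331Mult
    (hGZ : ∀ (N : ℕ) [NeZero N] (W : WeierstrassCurve ℚ) (K : Type) [Field K] [NumberField K],
      gross_zagier N W K)
    (hKo : ∀ (N : ℕ) [NeZero N] (W : WeierstrassCurve ℚ) (K : Type) [Field K] [NumberField K],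
      kolyvagin N W K)
    (hSk : Skinner2016.thmC_padicValRat_bsd_rank_zero)
    (hGZK : rank_eq_analyticRank_of_analyticRank_le_one) (hmod : hasEntireLFunction_rat)
    (h331 : JetchevSkinnerWan2017.thm331_anticyclotomicControl_mult)
    (hS : ∀ (W : WeierstrassCurve ℚ) [W.IsElliptic] [W.IsGloballyMinimal] [NeZero (W.conductorNorm ℤ)]
      (p : ℕ) [Fact p.Prime], ClassX11b W p → 5 ≤ p → Rank1Residual.Surj W p → Rank1Residual.Ram W p →
      p ∣ W.tamagawaProduct →
      ¬ ((∃ (q : ℕ) (_ : Fact q.Prime), q ≠ 2 ∧ q ≠ p ∧ Rank1Residual.Mult W q ∧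
          ¬ W.HasSplitMultiplicativeReductionAtPrime q ∧ ¬ p ∣ padicValInt q W.minimalDiscriminantInt) ∧
        (∀ P : (W.baseChange ℚ_[p]).toAffine.Point, p • P = 0 → P = 0)) →
      ∃ (K : Type) (_ : Field K) (_ : NumberField K)
        (Dt : ModularParametrizationData W (W.conductorNorm ℤ))
        (H : HeegnerDatum (W.conductorNorm ℤ) (NumberField.discr K)) (ι : K →+* ℂ)
        (P : (W.baseChange K).toAffine.Point)
        (Wd : WeierstrassCurve ℚ) (_ : Wd.IsElliptic) (_ : Wd.IsGloballyMinimal) (Cd : VariableChange ℚ) (qd : ℚ),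
        IsImaginaryQuadratic K ∧ Odd (NumberField.discr K) ∧ NumberField.discr K < -4 ∧
          SatisfiesHeegnerHypothesis (W.conductorNorm ℤ) K ∧
          WeierstrassCurve.Affine.Point.map ι.toRatAlgHom P = heegnerPointComplex Dt H ∧
          ¬ (p : ℤ) ∣ Dt.c ∧ ¬ IsOfFinAddOrder P ∧
          Cd • W.quadraticTwist (NumberField.discr K : ℚ) = Wd ∧
          Wd.entireLFunction 1 / (Wd.realPeriodRat : ℂ) = (qd : ℂ) ∧
          2 * (padicValNat p (AddSubgroup.zmultiples P).index : ℤ) ≤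
            padicValRat p qd + padicValNat p W.tamagawaProduct + 2 * padicValNat p Wd.torsionOrder) :
    ∀ (W : WeierstrassCurve ℚ) [W.IsElliptic] [W.IsGloballyMinimal] (p : ℕ) [Fact p.Prime],
      Literature.NumberTheory.EllipticCurves.Rank1Residual.Ram W p →
      ¬ ((∃ (q : ℕ) (_ : Fact q.Prime), q ≠ 2 ∧ q ≠ p ∧ Literature.NumberTheory.EllipticCurves.Rank1Residual.Mult W q ∧
          ¬ W.HasSplitMultiplicativeReductionAtPrime q ∧ ¬ p ∣ padicValInt q W.minimalDiscriminantInt) ∧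
        (∀ P : (W.baseChange ℚ_[p]).toAffine.Point, p • P = 0 → P = 0)) →
      p ∣ W.tamagawaProduct →
      Summit.BirchSwinnertonDyer.Rank1Residual.X11b.P2OpenInputOnTreeAt W p := by
  intro W _ _ p hp hram hno htam
  refine p2OpenInputOnTreeAt_of_imp_surj W p fun hX hp5 hs ↦ ?_
  haveI : NeZero (W.conductorNorm ℤ) := ⟨(W.conductorNorm_pos_holds).ne'⟩
  exact openInputOnTreeAt_of_exists_gzSharpDatum_of_thm331Mult W p hGZ hKo hSk hGZK hmod h331 hX hram
    (hS W p hX hp5 hs hram htam hno)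

/-- **The crux `RamNoErratumDataAtFive` (item 19624) BY THE ROUTE'S NAMES ⟸ GZ-sharp Heegner data on the REST‴ pairs**:
`PublishedInputsFive` (support item 19066; its Gross–Zagier, Kolyvagin, Skinner 2016 Thm. C, GZK and modularity conjuncts are
used) + `JSWAnticyclotomicControlMult` (19626) + `hS♯` asked on every X11b pair with `p ≥ 5`, `ρ̄` onto, a (ram) witness and
no erratum datum (Locus and off-Locus alike) ⟹ `RamNoErratumDataAtFive`. CONDITIONAL; `hS♯` is a per-pair certificate
currency, not a conjecture; nothing booked. [cite: Castella2018Erratum, Thm. 1.1 (iii)–(iv)]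
[cite: Gross1991, (1.1), Thm. 1.3] [cite: JetchevSkinnerWan2017, Thm. 3.3.1] [cite: Skinner2016PacificMC, Thm. C (§1)] -/
theorem ramNoErratumDataAtFive_of_publishedInputsFive_of_gzSharpData
    (hF : PublishedInputsFive) (h331 : JSWAnticyclotomicControlMult)
    (hS : ∀ (W : WeierstrassCurve ℚ) [W.IsElliptic] [W.IsGloballyMinimal] [NeZero (W.conductorNorm ℤ)]
      (p : ℕ) [Fact p.Prime], ClassX11b W p → 5 ≤ p → Rank1Residual.Surj W p → Rank1Residual.Ram W p →
      ¬ ((∃ (q : ℕ) (_ : Fact q.Prime), q ≠ 2 ∧ q ≠ p ∧ Rank1Residual.Mult W q ∧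
          ¬ W.HasSplitMultiplicativeReductionAtPrime q ∧ ¬ p ∣ padicValInt q W.minimalDiscriminantInt) ∧
        (∀ P : (W.baseChange ℚ_[p]).toAffine.Point, p • P = 0 → P = 0)) →
      ∃ (K : Type) (_ : Field K) (_ : NumberField K)
        (Dt : ModularParametrizationData W (W.conductorNorm ℤ))
        (H : HeegnerDatum (W.conductorNorm ℤ) (NumberField.discr K)) (ι : K →+* ℂ)
        (P : (W.baseChange K).toAffine.Point)
        (Wd : WeierstrassCurve ℚ) (_ : Wd.IsElliptic) (_ : Wd.IsGloballyMinimal) (Cd : VariableChange ℚ) (qd : ℚ),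
        IsImaginaryQuadratic K ∧ Odd (NumberField.discr K) ∧ NumberField.discr K < -4 ∧
          SatisfiesHeegnerHypothesis (W.conductorNorm ℤ) K ∧
          WeierstrassCurve.Affine.Point.map ι.toRatAlgHom P = heegnerPointComplex Dt H ∧
          ¬ (p : ℤ) ∣ Dt.c ∧ ¬ IsOfFinAddOrder P ∧
          Cd • W.quadraticTwist (NumberField.discr K : ℚ) = Wd ∧
          Wd.entireLFunction 1 / (Wd.realPeriodRat : ℂ) = (qd : ℂ) ∧
          2 * (padicValNat p (AddSubgroup.zmultiples P).index : ℤ) ≤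
            padicValRat p qd + padicValNat p W.tamagawaProduct + 2 * padicValNat p Wd.torsionOrder) :
    RamNoErratumDataAtFive := by
  obtain ⟨hGZ, hKo, -, hSk, -, hGZK, hmod, -, -, -, -, -, -, -, -⟩ := hF
  intro W _ _ p hp hram hno
  refine p2OpenInputOnTreeAt_of_imp_surj W p fun hX hp5 hs ↦ ?_
  haveI : NeZero (W.conductorNorm ℤ) := ⟨(W.conductorNorm_pos_holds).ne'⟩
  exact openInputOnTreeAt_of_exists_gzSharpDatum_of_thm331Mult W p hGZ hKo hSk hGZK hmod h331 hX hram
    (hS W p hX hp5 hs hram hno)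

end Summit.BirchSwinnertonDyer.BirchSwinnertonDyer.Theorems

end
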